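import Mathlib
import Summits.ResolutionOfSingularities.ResolutionOfSingularities.Theorems.RadicialJungCleanModelsCleanProp44LeafTowerStep
import HarnessLib

/-!
# Route `RadicialJung`, crux `CleanModels` (stmt-ResolutionOfSingularities-15917), line `Sketch` rev 35, stub 6 `stub_cleanProp44` (X44c):
# THE `δ`-FACE PRESENTED AS A POLYNOMIAL AND THE RESTRICTED UNIT `U|_{Γ″} = −v(c)·λ` — recipe steps (2) and (4) over an abstract chart cocone, def-free

Seat decomp-res-hand-2 g21 (structural hand); sequel of ✓ `…LeafTowerStep` (`leafSum_tower_bottom`: at the bottom of the tower `f_d ≡ Σ_{e≤μ} t_d^e g_e (mod v_d)`,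
`g_e ≡` the images of the dehomogenised initial forms `G_e^{τ♯}(uf)`, ✓ `leafSum_base` + `map_sub_mem_span_map`) and the input of ✓ `…SolvableFace` /
✓ `…SuccessorCount` (`births_on_successor_le`: the face `Φ ∈ κ[u][T]`, `deg_T Φ ≤ μ`, top coefficient a non-zero constant, `deg_u Φ_0 ≤ μδ`; a restriction map
`φ : O → κ[u]` killing the ideal of `Γ″` with `φ U = a₀·λ`).  Memo 4e §2.5: «after blowing up `Z_{j*}` (`m := δ` divisions in all) `J_m|_{u₁=0} ∋ Σ_e t_m^e C_e(u₂′)`,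
`C_e(u) = Σ_b c_{e,(μ−e)δ−b,b} u^b` (`deg C_e ≤ (μ−e)δ`), i.e. the `δ`-FACE … on the exceptional locus over `c` every unit pulled back from `X` is constant, so
`U := v·t_m` restricts to `U|_{Γ″} = −v(c)·λ(u₂′)`».  THIS FILE types both over ABSTRACT CHART DATA (the instantiation on the tree's `IsBlowup`s is census (S)):
a ring `B` (chart ring of the last blowing up), the CHART MAP OF THE EXCEPTIONAL DIVISOR `ε : B → S` into a `κ[u][T]`-algebra `S` (`S = κ[u][T]` on the chart
`E ∩ {u₁-chart} ≅ 𝔸²_κ`, or a localization of it at a point) with `ε(v_d) = 0`, `ε(t_d) = T`, and the COMPOSITE `B ← A_1 ← 𝒪_{X,c}` of the tower with the first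
stalk map behaving on `𝒪_{X,c}` as «reduce modulo `𝔪_c`, then constants» (`ε θ τ♯ r = σ(r)`, `σ : 𝒪_{X,c} → κ` the residue map) and on the first chart's affine
coordinates as `ε θ (uf_i) = y_i ∈ κ[u]` (for the point blow-up in the `u₁`-chart: `y = (0, 1, u)` after `d ≥ 2` divisions):

* `natDegree_faceSum_le` / `coeff_faceSum` — the face polynomial `Φ = Σ_{e≤μ} T^e·C_e(u)`: `deg_T Φ ≤ μ`, `Φ_n = C_n`.
* `map_eq_faceSum` — **THE FACE** (recipe (2)): `f − Σ_{e≤μ} t^e g_e ∈ (v)`, `ε v = 0`, `ε t = T`, `ε g_e = C_e` ⟹ `ε f = Φ`.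
* `eval₂_eq_C_faceCoeff` / `natDegree_faceCoeff_le` / `faceCoeff_of_isHomogeneous_zero` — **THE COEFFICIENTS**: `ε θ (G^{τ♯}(uf)) = Ḡ^σ(y)`; for `G` homogeneous of
  degree `n` and `deg y_i ≤ 1`: `deg_u Ḡ^σ(y) ≤ n` (so `deg C_0 ≤ μδ`); for `n = 0`: `Ḡ^σ(y) = σ(G_0)` is the CONSTANT `σ(g_μ)` — non-zero iff the `t^μ`-coefficient
  `g_μ` of `f` is a unit (Case II normal form).
* `restriction_apply_eq_zero_of_map_eq` / `restriction_unit` / `restriction_face` — **THE RESTRICTION TO `Γ″ = V(v_d, T + λ)`** (recipe (4)):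
  `φ_λ := ev_{T ↦ −λ} ∘ ε : B → κ[u]` kills `v_d` and every `w` with `ε w = T + λ` (generators of the ideal of `Γ″` on the chart), sends the unit presentation
  `U = v′·t_d` (`ε v′ = v(c)` a constant: `v′ = θ τ♯ v`) to `−v(c)·λ`, and kills `f_d` when `Φ = c(T + λ)^μ` (`μ ≥ 1`).
* `exists_restriction_of_solvableFace` — packaged: the data `(φ, K ∋ v_d, w)` with `φ K = 0` and `φ U = (−v(c))·λ`, ready for ✓ `births_on_successor_le` /
  ✓ `sum_mul_natDegree_le_of_restriction`.

Honest framing: OURS, elementary; the construction of `ε`, `θ`, `y` from the tree's blowings up and the identification of `π` with the successor curve of [CoP1]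
Lemma 4.3 (5) are census (S), NOT done here; nothing here proves X44c, any case of `CleanModels`, or resolution of singularities in characteristic `p`.
[cite: CossartPiltant2008, Lemma 4.3 (4)–(5); Prop. 4.4 (proof, p. 11)] [cite: CossartJannsenSaito2020, Lemma 7.5, Def. 7.1]
-/

noncomputable section

set_option linter.dupNamespace false -- mandated namespace of this single-conjunct summit

open Polynomial

namespace Summit.ResolutionOfSingularities.ResolutionOfSingularities.Theorems.RadicialJung.CleanModels

variable {k : Type*} [Field k]

/-! ## §1 The face polynomial `Φ = Σ_{e≤μ} T^e · C_e(u)` -/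

/-- `deg_T (Σ_{e≤μ} T^e·C_e) ≤ μ`. [folklore] -/
theorem natDegree_faceSum_le (μ : ℕ) (Cf : ℕ → k[X]) :
    (∑ e ∈ Finset.range (μ + 1), (X : (k[X])[X]) ^ e * C (Cf e)).natDegree ≤ μ := by
  refine natDegree_sum_le_of_forall_le _ _ fun e he => ?_
  have he' : e ≤ μ := by simpa [Finset.mem_range, Nat.lt_succ_iff] using he
  calc ((X : (k[X])[X]) ^ e * C (Cf e)).natDegree ≤ ((X : (k[X])[X]) ^ e).natDegree + (C (Cf e)).natDegree := natDegree_mul_le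
    _ ≤ e + 0 := by rw [natDegree_C]; exact Nat.add_le_add_right (natDegree_pow_le_of_le e natDegree_X_le |>.trans (by simp)) 0
    _ ≤ μ := by omega

/-- The coefficients of the face polynomial: `Φ_n = C_n` for `n ≤ μ`. [folklore] -/
theorem coeff_faceSum (μ : ℕ) (Cf : ℕ → k[X]) {n : ℕ} (hn : n ≤ μ) :
    (∑ e ∈ Finset.range (μ + 1), (X : (k[X])[X]) ^ e * C (Cf e)).coeff n = Cf n := by
  rw [finsetSum_coeff]
  simp_rw [mul_comm ((X : (k[X])[X]) ^ _) (C _), coeff_C_mul_X_pow]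
  rw [Finset.sum_eq_single n]
  · simp
  · intro e _ hne; simp [Ne.symm hne]
  · intro h; exact absurd (Finset.mem_range.mpr (by omega)) h

/-! ## §2 The face at the bottom of the tower -/

section Face

variable {B S : Type*} [CommRing B] [CommRing S] [Algebra (k[X])[X] S] (ε : B →+* S)

/-- **THE `δ`-FACE PRESENTED** (recipe step (2)): at the bottom of the tower `f − Σ_{e≤μ} t^e g_e ∈ (v)` (✓ `leafSum_tower_bottom`); the chart map of the
exceptional divisor `ε : B → S` (`S` a `κ[u][T]`-algebra: the chart `𝔸²_κ` of `E`, or a localization of it) with `ε v = 0`, `ε t = T`, `ε g_e = C_e(u)` gives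
`ε f = Φ := Σ_{e≤μ} T^e·C_e(u)`. [cite: CossartPiltant2008, Prop. 4.4 (proof, p. 11)] [cite: CossartJannsenSaito2020, Lemma 7.5] -/
theorem map_eq_faceSum (μ : ℕ) {t v f : B} (g : ℕ → B) (hface : f - ∑ e ∈ Finset.range (μ + 1), t ^ e * g e ∈ Ideal.span {v})
    (hv : ε v = 0) (ht : ε t = algebraMap (k[X])[X] S X) (Cf : ℕ → k[X])
    (hg : ∀ e ≤ μ, ε (g e) = algebraMap (k[X])[X] S (C (Cf e))) :
    ε f = algebraMap (k[X])[X] S (∑ e ∈ Finset.range (μ + 1), (X : (k[X])[X]) ^ e * C (Cf e)) := by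
  obtain ⟨s, hs⟩ := Ideal.mem_span_singleton'.mp hface
  have h1 : ε f = ε (∑ e ∈ Finset.range (μ + 1), t ^ e * g e) := by
    have h2 : ε (f - ∑ e ∈ Finset.range (μ + 1), t ^ e * g e) = 0 := by rw [← hs, map_mul, hv, mul_zero]
    rwa [map_sub, sub_eq_zero] at h2
  rw [h1, map_sum, map_sum]
  refine Finset.sum_congr rfl fun e he => ?_
  have he' : e ≤ μ := by simpa [Finset.mem_range, Nat.lt_succ_iff] using he
  rw [map_mul, map_pow, ht, hg e he', map_mul, map_pow]

/-- The chart-ring case `S = κ[u][T]`: `ε f = Φ` on the nose. [cite: CossartPiltant2008, Prop. 4.4 (proof, p. 11)] -/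
theorem map_eq_faceSum' (ε : B →+* (k[X])[X]) (μ : ℕ) {t v f : B} (g : ℕ → B)
    (hface : f - ∑ e ∈ Finset.range (μ + 1), t ^ e * g e ∈ Ideal.span {v})
    (hv : ε v = 0) (ht : ε t = X) (Cf : ℕ → k[X]) (hg : ∀ e ≤ μ, ε (g e) = C (Cf e)) :
    ε f = ∑ e ∈ Finset.range (μ + 1), (X : (k[X])[X]) ^ e * C (Cf e) := by
  have := map_eq_faceSum (S := (k[X])[X]) ε μ g hface hv (by simpa using ht) Cf (fun e he => by simpa using hg e he)
  simpa using this

end Face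

/-! ## §3 The coefficients: dehomogenised initial forms modulo `𝔪_c` -/

section Coeff

variable {R A B : Type*} [CommRing R] [CommRing A] [CommRing B] {σι : Type*}

/-- **The coefficients of the face** (recipe step (2), continued): if the composite `ε ∘ θ` (`θ : A → B` the tower, `ε` the chart map of `E`) acts on the base
ring `R = 𝒪_{X,c}` through `τ♯ : R → A` as `C ∘ C ∘ σ` (`σ : R → κ` the residue map: pulled-back functions are CONSTANT on the exceptional locus over `c`) and sends
the first chart's coordinates `uf_i` to `C(y_i)`, `y_i ∈ κ[u]`, then `ε θ (G^{τ♯}(uf)) = C(Ḡ^σ(y))` with `Ḡ^σ(y) = eval₂ (C ∘ σ) y G ∈ κ[u]`. [folklore] -/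
theorem map_eval₂_eq_C_faceCoeff (τ : R →+* A) (θ : A →+* B) (ε : B →+* (k[X])[X]) (σ : R →+* k)
    (hσ : ∀ r, ε (θ (τ r)) = C (C (σ r))) (uf : σι → A) (y : σι → k[X]) (hy : ∀ i, ε (θ (uf i)) = C (y i))
    (G : MvPolynomial σι R) :
    ε (θ (MvPolynomial.eval₂ τ uf G)) = C (MvPolynomial.eval₂ ((C : k →+* k[X]).comp σ) y G) := by
  rw [MvPolynomial.eval₂_comp_left θ, MvPolynomial.eval₂_comp_left ε, MvPolynomial.eval₂_comp_left (C : k[X] →+* (k[X])[X])]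
  congr 1
  · ext r; simp [hσ]
  · ext i : 1; simp [Function.comp, hy]

/-- **Degree of a face coefficient**: `G` homogeneous of degree `n`, `deg y_i ≤ 1` for all `i` ⟹ `deg_u Ḡ^σ(y) ≤ n`.  (For the point blow-up read after `d ≥ 2`
divisions in the `u₁`-chart, `y = (0, 1, u)`; with `n = k_0 = μδ` this is the weight bound `deg C_0 ≤ μδ` of ✓ `natDegree_le_of_solvableFace`.) [folklore] -/
theorem natDegree_faceCoeff_le [Fintype σι] (σ' : R →+* k[X]) (hσ' : ∀ r, (σ' r).natDegree = 0) (y : σι → k[X])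
    (hy : ∀ i, (y i).natDegree ≤ 1) {G : MvPolynomial σι R} {n : ℕ} (hG : G.IsHomogeneous n) :
    (MvPolynomial.eval₂ σ' y G).natDegree ≤ n := by
  classical
  rw [MvPolynomial.eval₂_eq']
  refine natDegree_sum_le_of_forall_le _ _ fun s hs => ?_
  have hd : s.degree = n := by
    by_contra h
    exact (MvPolynomial.mem_support_iff.mp hs) (hG.coeff_eq_zero h)
  calc (σ' (MvPolynomial.coeff s G) * ∏ i, y i ^ s i).natDegree
      ≤ (σ' (MvPolynomial.coeff s G)).natDegree + (∏ i, y i ^ s i).natDegree := natDegree_mul_le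
    _ ≤ 0 + ∑ i, (y i ^ s i).natDegree := by rw [hσ']; exact Nat.add_le_add_left (natDegree_prod_le _ _) 0
    _ ≤ 0 + ∑ i, s i := by
        refine Nat.add_le_add_left (Finset.sum_le_sum fun i _ => ?_) 0
        exact (natDegree_pow_le_of_le (s i) (hy i)).trans (by simp)
    _ = n := by
        rw [zero_add, ← hd, Finsupp.degree_apply]
        exact (Finset.sum_subset (Finset.subset_univ s.support) fun i _ hi => by
          simpa [Finsupp.mem_support_iff] using hi).symm

/-- The residue-then-constants map has degree `0` values. [folklore] -/
theorem natDegree_C_comp_apply (σ : R →+* k) (r : R) : (((C : k →+* k[X]).comp σ) r).natDegree = 0 := by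
  simp

/-- **The top coefficient is a constant**: a form of degree `0` is its constant coefficient, so `Ḡ^σ(y) = C(σ(G_0))` — for the face, `C_μ = σ(g_μ) = ` the
residue of the `t^μ`-coefficient of `f` (a NON-ZERO constant iff `g_μ` is a unit: the Case II normal form of memo 4e §2.5). [folklore] -/
theorem faceCoeff_of_isHomogeneous_zero (σ : R →+* k) (y : σι → k[X]) {G : MvPolynomial σι R} (hG : G.IsHomogeneous 0) :
    MvPolynomial.eval₂ ((C : k →+* k[X]).comp σ) y G = C (σ (MvPolynomial.coeff 0 G)) := by
  classical
  have h1 : G = MvPolynomial.C (MvPolynomial.coeff 0 G) := by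
    rw [← MvPolynomial.totalDegree_eq_zero_iff_eq_C]
    apply Nat.eq_zero_of_le_zero
    exact hG.totalDegree_le
  conv_lhs => rw [h1]
  rw [MvPolynomial.eval₂_C, RingHom.comp_apply]

end Coeff

/-! ## §4 The restriction to the successor `Γ″ = V(v_d, T + λ)` -/

section Restriction

variable {B : Type*} [CommRing B] (ε : B →+* (k[X])[X]) (lam : k[X])

/-- **The restriction map kills the ideal of `Γ″`** (recipe step (4)): `φ_λ := ev_{T ↦ −λ} ∘ ε` kills `v_d` (`ε v_d = 0`) and every `w` with `ε w = T + λ`.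
[cite: CossartPiltant2008, Prop. 4.4 (proof, p. 11)] -/
theorem restriction_apply_eq_zero_of_map_eq {v w : B} (hv : ε v = 0) (hw : ε w = X + C lam) :
    ∀ x ∈ Ideal.span ({v, w} : Set B), ((evalRingHom (-lam)).comp ε) x = 0 := by
  intro x hx
  obtain ⟨a, b, rfl⟩ := Ideal.mem_span_pair.mp hx
  simp [hv, hw]

/-- **THE RESTRICTED UNIT `U|_{Γ″} = −v(c)·λ`** (memo 4e §2.5 «THE BIRTHS on `Γ″`»): for the unit presentation `U = v′·t_d` with `ε v′ = v(c)` a constant (units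
pulled back from `X` are constant on the exceptional locus over `c`) and `ε t_d = T`: `φ_λ U = (−v(c))·λ`. [cite: CossartPiltant2008, Prop. 4.4 (proof, p. 11)] -/
theorem restriction_unit {v' t : B} {a₀ : k} (hv' : ε v' = C (C a₀)) (ht : ε t = X) :
    ((evalRingHom (-lam)).comp ε) (v' * t) = C (-a₀) * lam := by
  simp [hv', ht, C_neg]

/-- The constant `−v(c)` is non-zero. [folklore] -/
theorem neg_ne_zero_of_ne_zero {a₀ : k} (ha₀ : a₀ ≠ 0) : -a₀ ≠ 0 := neg_ne_zero.mpr ha₀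

/-- **`f_d` vanishes on `Γ″`**: if `ε f = c·(T + λ)^μ` (`μ ≥ 1`, the solvable face) then `φ_λ f = 0`. [cite: CossartPiltant2008, Lemma 4.3 (5)] -/
theorem restriction_face {f : B} {c : k} {μ : ℕ} (hμ : 1 ≤ μ) (hf : ε f = C (C c) * (X + C lam) ^ μ) :
    ((evalRingHom (-lam)).comp ε) f = 0 := by
  obtain ⟨m, rfl⟩ : ∃ m, μ = m + 1 := ⟨μ - 1, by omega⟩
  simp [hf]

/-- **PACKAGED** (the input of ✓ `births_on_successor_le` / ✓ `sum_mul_natDegree_le_of_restriction`): from the chart map `ε` of the exceptional divisor with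
`ε v_d = 0`, `ε t_d = T`, `ε v′ = v(c) ≠ 0`, and a lift `w` of the successor's equation (`ε w = T + λ`), the restriction map `φ = ev_{T↦−λ} ∘ ε : B → κ[u]` kills
`K = (v_d, w)` and sends `U = v′ t_d` to `a·λ` with `a = −v(c) ≠ 0`. [cite: CossartPiltant2008, Prop. 4.4 (proof, p. 11)] -/
theorem exists_restriction_of_solvableFace {v w v' t : B} (hv : ε v = 0) (hw : ε w = X + C lam) {a₀ : k} (ha₀ : a₀ ≠ 0)
    (hv' : ε v' = C (C a₀)) (ht : ε t = X) :
    ∃ (φ : B →+* k[X]) (a : k), a ≠ 0 ∧ (∀ x ∈ Ideal.span ({v, w} : Set B), φ x = 0) ∧ φ (v' * t) = C a * lam ∧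
      ∀ x, φ x = eval (-lam) (ε x) :=
  ⟨(evalRingHom (-lam)).comp ε, -a₀, neg_ne_zero_of_ne_zero ha₀, restriction_apply_eq_zero_of_map_eq ε lam hv hw,
    restriction_unit ε lam hv' ht, fun _ => rfl⟩

end Restriction

end Summit.ResolutionOfSingularities.ResolutionOfSingularities.Theorems.RadicialJung.CleanModels

end
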